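import Summits.QuantumFields.BalabanUV.T4Continuum.Spine.NE9.SummableMemory
import Literature.Probability.Process.RenewalTheoremGeneral

/-!
# T⁴ programme, node U6 in KING'S CURRENCY — matching modulo constants of the runs with `K` and `K + n` steps, UNIFORMLY IN `n`,
# with remainders that merely TEND TO ZERO, gives the Cauchy property of the generating functions; a c₀ scale profile gives
# transported totals `delta E ρ inj K → 0`; the cell's consecutive socket (`MatchingModConstants` + `Summable δ`) IMPLIES King's —
# census item C30 of cell `pub-balaban-gaps`, seat ne9 (gen 6), the U6 half (E-side half: `Spine/NE9/DirectPairing`)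

Cell `pub-balaban-gaps` (YM blitz G2, seat ne9, unit `pub-balaban-gaps-ne9-g6`; record `run/shared/lean/pub/pub-balaban-gaps/ne/NE9.md`
§5 row C30).  Summits-side bookkeeping; elementary real analysis over `T4CauchySum`'s vocabulary (`delta`, `genFun`, `genFunLim`,
`MatchingModConstants`); by-name inputs `SummableMemory.delta_le_scaleProfile` (gen 2) and the dominated-convergence lemma for discrete
convolutions `Literature.Probability.Process.Renewal.tendsto_sum_antidiagonal_mul` (Madras–Slade App. B).  No definition is made: King's
matching shape is written INLINE as a hypothesis (`∀ K n, ∃ c, ∀ |t| ≤ l₀, |log Z_{K+n}(t) − log Z_K(t) − c| ≤ vol·δ_K`).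

WHY.  `T4CauchySum` (node U6) follows its printed template — C. King, Commun. Math. Phys. **102** (1986), Thm 3.4 p. 656, *"the bound
(3.9) on the difference of the effective actions S^{(k)} and S^{(k+n)} generated from the lattices T_{ε_K} and T_{ε_{K+n}}"*, p. 657 *"Hence
{Z^{ε_K}(T_{ε_K}, g, h)} is a Cauchy sequence"* — EXCEPT in one point: it compares CONSECUTIVE cutoffs (`MatchingModConstants`: `K` against
`K + 1`) and therefore needs `Summable δ` (`cauchySeq_genFun`), where King compares `K` against `K + n` and needs only `δ_K → 0` uniformly in
`n`.  For geometric sources the two organisations are equivalent; for the E-side history bracket (NE9) they are NOT: the slow tower of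
`MemoryFromRateSharp` (gen 4, row C26) has a bracket majorant `≍ 1∕m` — not summable, but tending to zero.  This file supplies the U6 half
of the direct organisation:
* §1 `tendsto_delta_of_profile`: an injection dominated by a scale profile `b_j → 0` (`0 ≤ inj K j ≤ b_j`, cutoff-uniform) has
  `delta E ρ inj K = E·Σ_{j+n=K} inj K j·ρ^n → 0` (`0 ≤ ρ < 1`; c₀ ∗ ℓ¹ ⊆ c₀) — compare gen 2's `summable_delta_of_scaleProfile` (ℓ¹ ∗ ℓ¹ ⊆ ℓ¹).
* §2 King's socket: `abs_genFun_add_sub_le` (`|genFun Z (K+n) t − genFun Z K t| ≤ 2·vol·δ_K`), `cauchySeq_genFun_of_unif` (`δ_K → 0` ⇒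
  Cauchy), `tendsto_genFun_of_unif`, `abs_genFun_sub_lim_le_of_unif` (tail bound `2·vol·δ_K`, no series), `tendstoUniformlyOn_genFun_of_unif`
  (uniform on the closed `l₀`-ball — the input node U0 consumes, `T4CauchySum.cauchySum`'s last conjunct).
* §3 `kingShape_of_matchingModConstants`: the cell's consecutive socket with `δ ≥ 0` summable (and `vol ≥ 0`) IMPLIES King's shape with the
  tails `Σ_m δ_{m+K}` as remainders (`→ 0`): King's currency is NOT stronger than the cell's; on the E-side it is strictly weaker
  (`DirectPairingSharp`).

VERDICT FOR THE ROW (with `DirectPairing`): the necessity of a QUANTITATIVE modulus of continuity for node U3 → U6 (row C26) is a property of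
the consecutive organisation of node U6; in King's organisation, GIVEN tower-NE5, separate uniform continuity of each scale-`m` term in each
young coupling (per level) suffices.  REGIME (honest): King's organisation needs EVERY injected source for the pair (K, K+n) uniformly in
`n` — for the geometric one-step sources (NE2∕NE3∕NE5) a geometric series, for node U2 a summable K-uniform consecutive profile (its tails),
for NE6∕NE7 the same shapes at the common last scale; the polynomial-loss injected rate `InjectedRate C c θ` with `c > 0` is NOT n-uniform.
Nothing of this is instantiated on Bałaban's objects (instance 0∕1); classification of NE9 UNCHANGED in kind (WORK-bound on W1).

HONEST FRAMING: bookkeeping for rung (B)+1 on a FIXED finite four-torus; real analysis on hypothesis SHAPES; NE9 and NE5 NOT PRINTED ∕ NOT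
PROVED; spine PROVED 0∕9 unchanged; NOT UV stability, NOT the continuum limit, NOT infinite volume, NOT a mass gap, NOT Clay.
HONEST DEPENDENCY: continuum YM on T⁴ ⇐ BetaPertH ∧ nine spine estimates (0∕9 proved); BetaPertH ⇐ (D1) ∧ (D4) ∧ CAP+tail.

References (TYPES only): [King1986] = C. King, Commun. Math. Phys. **102** (1986) 649–677, Thm 3.4 (3.9) p. 656, p. 657;
[MadrasSlade1993] = N. Madras, G. Slade, *The Self-Avoiding Walk* (1993), App. B (the convolution limit, via the Literature lemma).
-/

namespace Summit.QuantumFields.BalabanUV.T4Continuum.NE9.DirectPairingCauchy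

open scoped BigOperators
open Finset Filter Topology
open Literature.MathematicalPhysics.QuantumFieldTheory.Balaban1983to89
open T4CauchySum (delta genFun genFunLim MatchingModConstants)

/-! ## §1 A c₀ scale profile gives transported totals tending to zero -/

/-- **`δ_K → 0` FROM ANY SCALE PROFILE TENDING TO ZERO.**  `0 ≤ E`, `0 ≤ ρ < 1`, a nonnegative profile `b_j → 0` and an injection with
`0 ≤ inj K j ≤ b_j` (`j ≤ K`) give `delta E ρ inj K → 0`: the geometric convolution of a null sequence is null (dominated convergence for
discrete convolutions, `Renewal.tendsto_sum_antidiagonal_mul` BY NAME).  The c₀ companion of gen 2's `summable_delta_of_scaleProfile`.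
[folklore] -/
theorem tendsto_delta_of_profile {E ρ : ℝ} {b : ℕ → ℝ} {inj : ℕ → ℕ → ℝ} (hE : 0 ≤ E) (hρ : 0 ≤ ρ) (hρ1 : ρ < 1)
    (hb0 : ∀ j, 0 ≤ b j) (hb : Tendsto b atTop (𝓝 0))
    (hinj : ∀ K j : ℕ, j ≤ K → 0 ≤ inj K j ∧ inj K j ≤ b j) :
    Tendsto (delta E ρ inj) atTop (𝓝 0) := by
  -- `b` is bounded
  obtain ⟨B, hB⟩ := hb.bddAbove_range
  have hbB : ∀ j, |b j| ≤ B := fun j => by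
    rw [abs_of_nonneg (hb0 j)]
    exact hB ⟨j, rfl⟩
  -- the geometric convolution of `b` tends to `(Σ ρ^j)·0 = 0`
  have hconv : Tendsto (fun K => ∑ p ∈ antidiagonal K, ρ ^ p.1 * b p.2) atTop (𝓝 0) := by
    have h := Literature.Probability.Process.Renewal.tendsto_sum_antidiagonal_mul (g := fun n => ρ ^ n) (u := b)
      (fun n => pow_nonneg hρ n) (summable_geometric_of_lt_one hρ hρ1) hbB hb
    simpa using h
  refine squeeze_zero (g := fun K => E * ∑ p ∈ antidiagonal K, ρ ^ p.1 * b p.2) (fun K => ?_) (fun K => ?_) ?_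
  · unfold delta
    exact mul_nonneg hE (sum_nonneg fun p hp =>
      mul_nonneg (hinj K p.1 (by have := mem_antidiagonal.mp hp; omega)).1 (pow_nonneg hρ _))
  · unfold delta
    refine mul_le_mul_of_nonneg_left ?_ hE
    have hswap : ∑ p ∈ antidiagonal K, inj K p.1 * ρ ^ p.2 = ∑ p ∈ antidiagonal K, inj K p.2 * ρ ^ p.1 :=
      Nat.sum_antidiagonal_swap (f := fun p => inj K p.2 * ρ ^ p.1)
    rw [hswap]
    refine sum_le_sum fun p hp => ?_
    have hj : p.2 ≤ K := by have := mem_antidiagonal.mp hp; omega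
    rw [mul_comm]
    exact mul_le_mul_of_nonneg_left (hinj K p.2 hj).2 (pow_nonneg hρ _)
  · simpa using hconv.const_mul E

/-! ## §2 King's socket: matching modulo constants of runs `K` and `K + n`, uniformly in `n`, with remainders `δ_K → 0` -/

/-- **The n-uniform Cauchy bound on the generating functions**: if for all `K, n` there is a `t`-independent constant `c` with
`|log Z_{K+n}(t) − log Z_K(t) − c| ≤ vol·δ_K` on `|t| ≤ l₀` (King's shape: runs `n` cutoffs apart compared DIRECTLY), then
`|genFun Z (K+n) t − genFun Z K t| ≤ 2·(vol·δ_K)` there (`0 ≤ l₀`; the constant cancels between `t` and `0`).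
[cite: King1986, Thm 3.4 (3.9) p. 656] [folklore] -/
theorem abs_genFun_add_sub_le {vol l₀ : ℝ} {δ : ℕ → ℝ} {Z : ℕ → ℝ → ℝ}
    (h : ∀ K n : ℕ, ∃ c : ℝ, ∀ t : ℝ, |t| ≤ l₀ → |Real.log (Z (K + n) t) - Real.log (Z K t) - c| ≤ vol * δ K)
    (hl₀ : 0 ≤ l₀) (K n : ℕ) {t : ℝ} (ht : |t| ≤ l₀) :
    |genFun Z (K + n) t - genFun Z K t| ≤ 2 * (vol * δ K) := by
  obtain ⟨c, hc⟩ := h K n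
  have h1 := hc t ht
  have h0 := hc 0 (by simpa using hl₀)
  unfold genFun
  have e : Real.log (Z (K + n) t) - Real.log (Z (K + n) 0) - (Real.log (Z K t) - Real.log (Z K 0))
      = (Real.log (Z (K + n) t) - Real.log (Z K t) - c) - (Real.log (Z (K + n) 0) - Real.log (Z K 0) - c) := by
    ring
  rw [e]
  have tri := abs_sub_le (Real.log (Z (K + n) t) - Real.log (Z K t) - c) 0
    (Real.log (Z (K + n) 0) - Real.log (Z K 0) - c)
  simp only [sub_zero, zero_sub, abs_neg] at tri
  linarith

/-- **CAUCHY FROM NULL REMAINDERS** (King's organisation of node U6): under King's shape with `δ_K → 0`, every `K ↦ genFun Z K t`,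
`|t| ≤ l₀`, is a Cauchy sequence — NO summability of the remainders is used. [cite: King1986, p. 657] [folklore] -/
theorem cauchySeq_genFun_of_unif {vol l₀ : ℝ} {δ : ℕ → ℝ} {Z : ℕ → ℝ → ℝ}
    (h : ∀ K n : ℕ, ∃ c : ℝ, ∀ t : ℝ, |t| ≤ l₀ → |Real.log (Z (K + n) t) - Real.log (Z K t) - c| ≤ vol * δ K)
    (hl₀ : 0 ≤ l₀) (hδ : Tendsto δ atTop (𝓝 0)) {t : ℝ} (ht : |t| ≤ l₀) :
    CauchySeq fun K => genFun Z K t := by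
  refine Metric.cauchySeq_iff'.2 fun ε hε => ?_
  have h2 : Tendsto (fun K => 2 * (vol * δ K)) atTop (𝓝 0) := by
    simpa using (hδ.const_mul vol).const_mul 2
  obtain ⟨N, hN⟩ := Metric.tendsto_atTop.mp h2 ε hε
  refine ⟨N, fun n hn => ?_⟩
  obtain ⟨l, rfl⟩ := Nat.exists_eq_add_of_le hn
  rw [Real.dist_eq]
  have hb := abs_genFun_add_sub_le h hl₀ N l ht
  have hNN := hN N le_rfl
  rw [Real.dist_eq, sub_zero] at hNN
  exact hb.trans_lt ((le_abs_self _).trans_lt hNN)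

/-- … hence CONVERGENT, to `genFunLim Z t`. [folklore] -/
theorem tendsto_genFun_of_unif {vol l₀ : ℝ} {δ : ℕ → ℝ} {Z : ℕ → ℝ → ℝ}
    (h : ∀ K n : ℕ, ∃ c : ℝ, ∀ t : ℝ, |t| ≤ l₀ → |Real.log (Z (K + n) t) - Real.log (Z K t) - c| ≤ vol * δ K)
    (hl₀ : 0 ≤ l₀) (hδ : Tendsto δ atTop (𝓝 0)) {t : ℝ} (ht : |t| ≤ l₀) :
    Tendsto (fun K => genFun Z K t) atTop (𝓝 (genFunLim Z t)) :=
  (cauchySeq_genFun_of_unif h hl₀ hδ ht).tendsto_limUnder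

/-- **TAIL BOUND WITHOUT A SERIES**: `|genFun Z K t − genFunLim Z t| ≤ 2·vol·δ_K` (let `n → ∞` in `abs_genFun_add_sub_le`). [folklore] -/
theorem abs_genFun_sub_lim_le_of_unif {vol l₀ : ℝ} {δ : ℕ → ℝ} {Z : ℕ → ℝ → ℝ}
    (h : ∀ K n : ℕ, ∃ c : ℝ, ∀ t : ℝ, |t| ≤ l₀ → |Real.log (Z (K + n) t) - Real.log (Z K t) - c| ≤ vol * δ K)
    (hl₀ : 0 ≤ l₀) (hδ : Tendsto δ atTop (𝓝 0)) {t : ℝ} (ht : |t| ≤ l₀) (K : ℕ) :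
    |genFun Z K t - genFunLim Z t| ≤ 2 * (vol * δ K) := by
  have hlim := tendsto_genFun_of_unif h hl₀ hδ ht
  have hlim' : Tendsto (fun n => genFun Z (K + n) t) atTop (𝓝 (genFunLim Z t)) := by
    have h' := (tendsto_add_atTop_iff_nat K).2 hlim
    exact h'.congr fun n => by rw [add_comm]
  have hc : Tendsto (fun n => |genFun Z (K + n) t - genFun Z K t|) atTop (𝓝 |genFunLim Z t - genFun Z K t|) :=
    (hlim'.sub_const _).abs
  have hle := le_of_tendsto' hc fun n => abs_genFun_add_sub_le h hl₀ K n ht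
  rwa [abs_sub_comm] at hle

/-- **UNIFORM convergence on the closed `l₀`-ball** (the remainders do not depend on `t`) — the input node U0 consumes, obtained in
King's organisation from `δ_K → 0` alone. [folklore] -/
theorem tendstoUniformlyOn_genFun_of_unif {vol l₀ : ℝ} {δ : ℕ → ℝ} {Z : ℕ → ℝ → ℝ}
    (h : ∀ K n : ℕ, ∃ c : ℝ, ∀ t : ℝ, |t| ≤ l₀ → |Real.log (Z (K + n) t) - Real.log (Z K t) - c| ≤ vol * δ K)
    (hl₀ : 0 ≤ l₀) (hδ : Tendsto δ atTop (𝓝 0)) :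
    TendstoUniformlyOn (fun K t => genFun Z K t) (genFunLim Z) atTop {t | |t| ≤ l₀} := by
  rw [Metric.tendstoUniformlyOn_iff]
  intro ε hε
  have h2 : Tendsto (fun K => 2 * (vol * δ K)) atTop (𝓝 0) := by
    simpa using (hδ.const_mul vol).const_mul 2
  filter_upwards [h2.eventually (gt_mem_nhds hε)] with K hK t ht
  rw [dist_comm, Real.dist_eq]
  exact (abs_genFun_sub_lim_le_of_unif h hl₀ hδ ht K).trans_lt hK

/-- **NODE U6 IN KING'S CURRENCY, assembled.**  A nonnegative scale profile `b_j → 0` dominating the n-UNIFORM injection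
(`0 ≤ inj K j ≤ b_j`, `j ≤ K` — on the E-side this is `DirectPairing.directBracket_eventually_le`'s output), contraction `0 ≤ ρ < 1`,
`0 ≤ E`, and King's matching shape with remainders `delta E ρ inj`: the transported totals tend to zero, every `K ↦ genFun Z K t`
(`|t| ≤ l₀`) is Cauchy, and the convergence to `genFunLim Z` is uniform on the closed `l₀`-ball.  A CONDITIONAL kernel theorem: none of its
hypotheses is in print for Bałaban's d = 4 procedure. [folklore] -/
theorem cauchy_of_kingShape {E ρ vol l₀ : ℝ} {b : ℕ → ℝ} {inj : ℕ → ℕ → ℝ} {Z : ℕ → ℝ → ℝ}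
    (hE : 0 ≤ E) (hρ : 0 ≤ ρ) (hρ1 : ρ < 1) (hb0 : ∀ j, 0 ≤ b j) (hb : Tendsto b atTop (𝓝 0))
    (hinj : ∀ K j : ℕ, j ≤ K → 0 ≤ inj K j ∧ inj K j ≤ b j) (hl₀ : 0 ≤ l₀)
    (hU5 : ∀ K n : ℕ, ∃ c : ℝ, ∀ t : ℝ, |t| ≤ l₀ →
      |Real.log (Z (K + n) t) - Real.log (Z K t) - c| ≤ vol * delta E ρ inj K) :
    Tendsto (delta E ρ inj) atTop (𝓝 0) ∧
    (∀ t : ℝ, |t| ≤ l₀ → CauchySeq fun K => genFun Z K t) ∧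
    TendstoUniformlyOn (fun K t => genFun Z K t) (genFunLim Z) atTop {t | |t| ≤ l₀} := by
  have hδ := tendsto_delta_of_profile hE hρ hρ1 hb0 hb hinj
  exact ⟨hδ, fun t ht => cauchySeq_genFun_of_unif hU5 hl₀ hδ ht, tendstoUniformlyOn_genFun_of_unif hU5 hl₀ hδ⟩

/-! ## §3 The cell's consecutive socket IMPLIES King's shape (with the tails as remainders) -/

/-- **CONSECUTIVE ⇒ DIRECT.**  `MatchingModConstants vol l₀ δ Z` (runs `K`, `K+1`) with `vol ≥ 0` and `δ ≥ 0` summable gives King's shape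
for the runs `K`, `K + n` with the constant `Σ_{l<n} c_{K+l}` and the remainder `vol·Σ_m δ_{m+K}` (the TAIL, which tends to zero by
`tendsto_sum_nat_add`): the cell's organisation of node U6 is at least as strong as King's.  (The converse fails on the E-side:
`DirectPairingSharp`.) [folklore] -/
theorem kingShape_of_matchingModConstants {vol l₀ : ℝ} {δ : ℕ → ℝ} {Z : ℕ → ℝ → ℝ}
    (h : MatchingModConstants vol l₀ δ Z) (hvol : 0 ≤ vol) (hδ0 : ∀ K, 0 ≤ δ K) (hδ : Summable δ) :
    ∀ K n : ℕ, ∃ c : ℝ, ∀ t : ℝ, |t| ≤ l₀ →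
      |Real.log (Z (K + n) t) - Real.log (Z K t) - c| ≤ vol * ∑' m, δ (m + K) := by
  choose c hc using h
  intro K n
  refine ⟨∑ l ∈ range n, c (K + l), fun t ht => ?_⟩
  -- finite telescoping through the intermediate runs
  have hfin : ∀ n : ℕ, |Real.log (Z (K + n) t) - Real.log (Z K t) - ∑ l ∈ range n, c (K + l)| ≤
      vol * ∑ l ∈ range n, δ (K + l) := by
    intro n
    induction n with
    | zero => simp
    | succ n ih =>
      rw [sum_range_succ, sum_range_succ, mul_add, show K + (n + 1) = K + n + 1 from rfl]
      have h1 := hc (K + n) t ht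
      have e : Real.log (Z (K + n + 1) t) - Real.log (Z K t) - (∑ l ∈ range n, c (K + l) + c (K + n))
          = (Real.log (Z (K + n + 1) t) - Real.log (Z (K + n) t) - c (K + n))
            + (Real.log (Z (K + n) t) - Real.log (Z K t) - ∑ l ∈ range n, c (K + l)) := by ring
      rw [e]
      exact (abs_add_le _ _).trans (by linarith)
  refine (hfin n).trans (mul_le_mul_of_nonneg_left ?_ hvol)
  have hs : Summable (fun m => δ (m + K)) := (summable_nat_add_iff K).2 hδ
  calc ∑ l ∈ range n, δ (K + l) = ∑ l ∈ range n, δ (l + K) := sum_congr rfl fun l _ => by rw [add_comm]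
    _ ≤ ∑' m, δ (m + K) := hs.sum_le_tsum _ fun m _ => hδ0 _

/-- The tails `K ↦ Σ_m δ_{m+K}` tend to zero — so `kingShape_of_matchingModConstants` feeds `cauchySeq_genFun_of_unif` and recovers
`T4CauchySum.cauchySeq_genFun` through King's currency. [folklore] -/
theorem cauchySeq_genFun_of_matchingModConstants {vol l₀ : ℝ} {δ : ℕ → ℝ} {Z : ℕ → ℝ → ℝ}
    (h : MatchingModConstants vol l₀ δ Z) (hvol : 0 ≤ vol) (hδ0 : ∀ K, 0 ≤ δ K) (hδ : Summable δ) (hl₀ : 0 ≤ l₀)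
    {t : ℝ} (ht : |t| ≤ l₀) : CauchySeq fun K => genFun Z K t :=
  cauchySeq_genFun_of_unif (kingShape_of_matchingModConstants h hvol hδ0 hδ) hl₀ (tendsto_sum_nat_add δ) ht

end Summit.QuantumFields.BalabanUV.T4Continuum.NE9.DirectPairingCauchy
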